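import Literature.NumberTheory.Automorphic.ArchBigCellTransport
import Literature.Analysis.Distribution.TranslationQuasiInvariantFunctionalOn
import Mathlib.Analysis.SpecialFunctions.Exponential
import HarnessLib

/-!
# Invariant derivatives of transported test functions on the big Bruhat cell of `GL_n(K_∞)`

Topic `NumberTheory/Automorphic`; namespace `Literature.NumberTheory.Automorphic`. For the push-forward
`cellPush h = h ∘ Ψ⁻¹` (extended by zero) of `ArchBigCellTransport`, the right- and left-invariant
derivatives of `GL_n(K_∞)` are first-order operators in the coordinates of the big cell:

* `cellVecR X e = dΨ⁻¹_{Ψ e}(Ψ(e) X)`, `cellVecL X e = dΨ⁻¹_{Ψ e}(-X Ψ(e))` — the vector fields on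
  `cellSource` corresponding to `R_X` and `L_X` (`contDiffOn_cellVecR/L`);
* `cellOpR X h (e) = Dh(e)[cellVecR X e]`, and **`R_X (cellPush h) = cellPush (cellOpR X h)`**
  (`archRightDeriv_cellPush`), `L_X (cellPush h) = cellPush (cellOpL X h)` (`archLeftDeriv_cellPush`), for `h`
  smooth with compact support in `cellSource`; `cellOpR X h` is again such a function
  (`contDiff_cellOpR`, `tsupport_cellOpR_subset`), so the identities iterate over words
  (`archRightWordDeriv_cellPush`, `archLeftWordDeriv_cellPush`);
* **normal form and bounds**: applying vector fields with coefficients smooth on `cellSource` to `h` yields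
  `Σ_w c_w · ∂_w h` with `∂_w` the nested directional derivatives of
  `Literature.Analysis.Distribution.vecWordDeriv` along a basis (`OpList`, `evalOpList`, `opListStep`,
  `vecField_apply_evalOpList`), whence on a compact `κ ⊆ cellSource`
  `sup |L_u R_v (cellPush h)| ≤ C · max_w sup |∂_w h|` (`exists_bound_wordDeriv_cellPush`);
* **`isFiniteOrderOn_cellPull`**: for a distribution `T` on `GL_n(K_∞)` (`IsArchDistribution`) the functional
  `cellPull T h = T (cellPush h)` is of finite order on `cellSource`
  (`Literature.Analysis.Distribution.IsFiniteOrderOn`), additive and homogeneous.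

Everything is proved; no named fact is introduced.

## References

* J. A. Shalika, *The multiplicity one theorem for `GL_n`*, Ann. of Math. 100 (1974), §2 [Shalika1974].
* L. Hörmander, *The Analysis of Linear Partial Differential Operators I* (1983), Def. 2.1.1, Thm. 2.1.3
  (distributions and changes of variables) [HormanderALPDO1].
-/

noncomputable section

open MeasureTheory Measure NumberField NumberField.mixedEmbedding IsDedekindDomain Set Filter Matrix
open Literature.Analysis.Distribution
open scoped MatrixGroups Topology Classical ContDiff Matrix.Norms.Operator

namespace Literature.NumberTheory.Automorphic

variable {n : ℕ} {K : Type} [Field K] [NumberField K]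

-- as in `ArchGardingWhittaker`: the scoped `L∞`-operator normed ring structure on matrices is only
-- reducibly defeq to the Pi uniformity
set_option backward.isDefEq.respectTransparency false

local notation "R∞" => mixedSpace K
local notation "Mat" => Matrix (Fin n) (Fin n) (mixedSpace K)
local notation "G∞" => GL (Fin n) (mixedSpace K)
local notation "E∞" => CellParam n (mixedSpace K)

/-- `M_n(K_∞)` is finite-dimensional over `ℝ` (a local instance, as `finiteDimensional_matrix_mixedSpace` of
`GLnCuspidalSpectrumSiegelProofs`: the instance is not found by unification through `mixedSpace`).
[folklore] -/
private theorem finiteDimensional_matrix_mixedSpace_cell : FiniteDimensional ℝ (Matrix (Fin n) (Fin n) (mixedSpace K)) :=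
  Module.Finite.matrix

attribute [local instance] finiteDimensional_matrix_mixedSpace_cell

/-- The parameter space `𝔫 × K_∞ⁿ × 𝔫` is finite-dimensional over `ℝ`. [folklore] -/
private theorem finiteDimensional_cellParam : FiniteDimensional ℝ (CellParam n (mixedSpace K)) := by
  unfold CellParam; infer_instance

attribute [local instance] finiteDimensional_cellParam

/-! ### 1. The vector fields of `R_X` and `L_X` in coordinates -/

section VectorFields

/-- **The vector field of `R_X` on the parameter space**: `cellVecR X e = dΨ⁻¹_{Ψ e}(Ψ(e) X)`. [folklore] -/
def cellVecR (X : Mat) (e : E∞) : E∞ :=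
  fderiv ℝ (cellChartHomeo n R∞).symm (cellChart e) (cellChart e * X)

/-- **The vector field of `L_X` on the parameter space**: `cellVecL X e = dΨ⁻¹_{Ψ e}(-X Ψ(e))`. [folklore] -/
def cellVecL (X : Mat) (e : E∞) : E∞ :=
  fderiv ℝ (cellChartHomeo n R∞).symm (cellChart e) (-(X * cellChart e))

/-- `e ↦ dΨ⁻¹_{Ψ e}` is smooth on `cellSource`. [folklore] -/
theorem contDiffOn_fderiv_symm_cellChart :
    ContDiffOn ℝ ∞ (fun e : E∞ => fderiv ℝ (cellChartHomeo n R∞).symm (cellChart e)) (cellSource n R∞) := by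
  have h1 : ContDiffOn ℝ ∞ (fderiv ℝ (cellChartHomeo n R∞).symm) (bruhatBigCell n R∞) :=
    contDiffOn_cellChartHomeo_symm.fderiv_of_isOpen isOpen_bruhatBigCell (by simp)
  refine h1.comp contDiff_cellChart.contDiffOn fun e he => ?_
  exact (cellChartHomeo n R∞).map_source he

/-- `cellVecR X` is smooth on `cellSource`. [folklore] -/
theorem contDiffOn_cellVecR (X : Mat) : ContDiffOn ℝ ∞ (cellVecR (n := n) (K := K) X) (cellSource n R∞) :=
  contDiffOn_fderiv_symm_cellChart.clm_apply ((contDiff_cellChart.mul contDiff_const).contDiffOn)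

/-- `cellVecL X` is smooth on `cellSource`. [folklore] -/
theorem contDiffOn_cellVecL (X : Mat) : ContDiffOn ℝ ∞ (cellVecL (n := n) (K := K) X) (cellSource n R∞) :=
  contDiffOn_fderiv_symm_cellChart.clm_apply ((contDiff_const.mul contDiff_cellChart).neg.contDiffOn)

/-- **Applying a vector field**: `(ζ · h)(e) = Dh(e)[ζ e]`. [folklore] -/
def vecField (ζ : E∞ → E∞) (h : E∞ → ℂ) (e : E∞) : ℂ := fderiv ℝ h e (ζ e)

/-- The operator of `R_X` in coordinates. [folklore] -/
def cellOpR (X : Mat) (h : E∞ → ℂ) : E∞ → ℂ := vecField (cellVecR X) h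

/-- The operator of `L_X` in coordinates. [folklore] -/
def cellOpL (X : Mat) (h : E∞ → ℂ) : E∞ → ℂ := vecField (cellVecL X) h

/-- **Applying a vector field smooth on `cellSource` to a smooth function supported in `cellSource` gives a
smooth function** (off `cellSource` the function vanishes near every point). [folklore] -/
theorem contDiff_vecField {ζ : E∞ → E∞} (hζ : ContDiffOn ℝ ∞ ζ (cellSource n R∞)) {h : E∞ → ℂ}
    (hs : ContDiff ℝ ∞ h) (hW : tsupport h ⊆ cellSource n R∞) : ContDiff ℝ ∞ (vecField ζ h) := by
  refine contDiff_iff_contDiffAt.2 fun e => ?_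
  have hdf : ContDiff ℝ ∞ (fderiv ℝ h) := hs.fderiv_right (m := ∞) (by simp)
  by_cases he : e ∈ cellSource n R∞
  · exact hdf.contDiffAt.clm_apply (hζ.contDiffAt (isOpen_cellSource.mem_nhds he))
  · -- `fderiv h` vanishes near `e ∉ tsupport h`
    have hne : e ∉ tsupport (fderiv ℝ h) := fun h' => he (hW (tsupport_fderiv_subset ℝ h'))
    have hev : vecField ζ h =ᶠ[𝓝 e] fun _ => 0 := by
      have hopen : IsOpen (tsupport (fderiv ℝ h))ᶜ := (isClosed_tsupport _).isOpen_compl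
      filter_upwards [hopen.mem_nhds hne] with x hx
      simp only [vecField, image_eq_zero_of_notMem_tsupport hx, _root_.zero_apply]
    exact contDiffAt_const.congr_of_eventuallyEq hev

/-- The support of `ζ · h` is inside that of `h`. [folklore] -/
theorem tsupport_vecField_subset (ζ : E∞ → E∞) (h : E∞ → ℂ) : tsupport (vecField ζ h) ⊆ tsupport h := by
  refine (closure_mono fun e he => ?_).trans (tsupport_fderiv_subset ℝ (f := h))
  rw [Function.mem_support] at he ⊢
  intro h0
  exact he (by simp only [vecField, h0, _root_.zero_apply])

/-- `cellOpR X h` is smooth for smooth `h` supported in `cellSource`. [folklore] -/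
theorem contDiff_cellOpR (X : Mat) {h : E∞ → ℂ} (hs : ContDiff ℝ ∞ h) (hW : tsupport h ⊆ cellSource n R∞) :
    ContDiff ℝ ∞ (cellOpR X h) :=
  contDiff_vecField (contDiffOn_cellVecR X) hs hW

/-- `cellOpL X h` is smooth for smooth `h` supported in `cellSource`. [folklore] -/
theorem contDiff_cellOpL (X : Mat) {h : E∞ → ℂ} (hs : ContDiff ℝ ∞ h) (hW : tsupport h ⊆ cellSource n R∞) :
    ContDiff ℝ ∞ (cellOpL X h) :=
  contDiff_vecField (contDiffOn_cellVecL X) hs hW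

/-- `tsupport (cellOpR X h) ⊆ tsupport h`. [folklore] -/
theorem tsupport_cellOpR_subset (X : Mat) (h : E∞ → ℂ) : tsupport (cellOpR (n := n) (K := K) X h) ⊆ tsupport h :=
  tsupport_vecField_subset _ h

/-- `tsupport (cellOpL X h) ⊆ tsupport h`. [folklore] -/
theorem tsupport_cellOpL_subset (X : Mat) (h : E∞ → ℂ) : tsupport (cellOpL (n := n) (K := K) X h) ⊆ tsupport h :=
  tsupport_vecField_subset _ h

end VectorFields

/-! ### 2. `R_X (cellPush h) = cellPush (R̃_X h)` and `L_X (cellPush h) = cellPush (L̃_X h)` -/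

section FirstOrder

/-- The right exponential curve `s ↦ g exp(sX)` in `M_n(K_∞)` has derivative `g X` at `0`. [folklore] -/
theorem hasDerivAt_coe_mul_expGL (g : G∞) (X : Mat) :
    HasDerivAt (fun s : ℝ => ((g * expGL (s • X) : G∞) : Mat)) ((g : Mat) * X) 0 := by
  have h1 : HasDerivAt (fun s : ℝ => NormedSpace.exp (s • X)) (X * NormedSpace.exp ((0 : ℝ) • X)) 0 :=
    hasDerivAt_exp_smul_const' (𝕂 := ℝ) X 0
  rw [zero_smul, NormedSpace.exp_zero, mul_one] at h1
  have h2 := h1.const_mul (g : Mat)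
  refine h2.congr_of_eventuallyEq (Eventually.of_forall fun s => ?_)
  simp only [Units.val_mul, coe_expGL]

/-- The left exponential curve `s ↦ exp(sX)⁻¹ g` in `M_n(K_∞)` has derivative `-X g` at `0`. [folklore] -/
theorem hasDerivAt_coe_expGL_inv_mul (g : G∞) (X : Mat) :
    HasDerivAt (fun s : ℝ => (((expGL (s • X))⁻¹ * g : G∞) : Mat)) (-(X * (g : Mat))) 0 := by
  have h1 : HasDerivAt (fun s : ℝ => NormedSpace.exp (s • (-X))) ((-X) * NormedSpace.exp ((0 : ℝ) • (-X))) 0 :=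
    hasDerivAt_exp_smul_const' (𝕂 := ℝ) (-X) 0
  rw [zero_smul, NormedSpace.exp_zero, mul_one] at h1
  have h2 := h1.mul_const (g : Mat)
  rw [neg_mul] at h2
  refine h2.congr_of_eventuallyEq (Eventually.of_forall fun s => ?_)
  simp only [Units.val_mul, ← expGL_neg, coe_expGL, smul_neg]

/-- The right exponential curve is continuous. [folklore] -/
theorem continuous_coe_mul_expGL (g : G∞) (X : Mat) : Continuous fun s : ℝ => ((g * expGL (s • X) : G∞) : Mat) := by
  have h : (fun s : ℝ => ((g * expGL (s • X) : G∞) : Mat)) = fun s : ℝ => (g : Mat) * NormedSpace.exp (s • X) := by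
    funext s; simp only [Units.val_mul, coe_expGL]
  rw [h]
  exact continuous_const.mul (NormedSpace.exp_continuous.comp (continuous_id.smul continuous_const))

/-- The left exponential curve is continuous. [folklore] -/
theorem continuous_coe_expGL_inv_mul (g : G∞) (X : Mat) :
    Continuous fun s : ℝ => (((expGL (s • X))⁻¹ * g : G∞) : Mat) := by
  have h : (fun s : ℝ => (((expGL (s • X))⁻¹ * g : G∞) : Mat)) = fun s : ℝ => NormedSpace.exp (s • (-X)) * (g : Mat) := by
    funext s; simp only [Units.val_mul, ← expGL_neg, coe_expGL, smul_neg]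
  rw [h]
  exact (NormedSpace.exp_continuous.comp (continuous_id.smul continuous_const)).mul continuous_const

/-- **`R_X (cellPush h)` on the big cell**: the chain rule along `s ↦ Ψ⁻¹(g exp(sX))`. [folklore] -/
theorem archRightDeriv_cellPush_of_mem {h : E∞ → ℂ} (hs : ContDiff ℝ ∞ h) (X : Mat) {g : G∞} (hg : (g : Mat) ∈ bruhatBigCell n R∞) :
    archRightDeriv X (cellPush h) g =
      fderiv ℝ h ((cellChartHomeo n R∞).symm (g : Mat))
        (fderiv ℝ (cellChartHomeo n R∞).symm (g : Mat) ((g : Mat) * X)) := by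
  unfold archRightDeriv
  have hev_mem : ∀ᶠ s : ℝ in 𝓝 0, ((g * expGL (s • X) : G∞) : Mat) ∈ bruhatBigCell n R∞ := by
    have h0 : ((g * expGL ((0 : ℝ) • X) : G∞) : Mat) ∈ bruhatBigCell n R∞ := by
      simpa only [zero_smul, expGL_zero, mul_one] using hg
    exact (continuous_coe_mul_expGL g X).continuousAt.preimage_mem_nhds (isOpen_bruhatBigCell.mem_nhds h0)
  have hev : (fun s : ℝ => cellPush h (g * expGL (s • X))) =ᶠ[𝓝 0]
      fun s : ℝ => h ((cellChartHomeo n R∞).symm ((g * expGL (s • X) : G∞) : Mat)) := by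
    filter_upwards [hev_mem] with s hs'
    exact cellPush_apply_of_mem hs'
  rw [hev.deriv_eq]
  have hsymm : HasFDerivAt (cellChartHomeo n R∞).symm (fderiv ℝ (cellChartHomeo n R∞).symm (g : Mat)) (g : Mat) :=
    ((contDiffAt_cellChartHomeo_symm hg).differentiableAt (by simp)).hasFDerivAt
  have h1 := hsymm.comp_hasDerivAt_of_eq (0 : ℝ) (hasDerivAt_coe_mul_expGL g X)
    (by simp only [zero_smul, expGL_zero, mul_one])
  have hh : HasFDerivAt h (fderiv ℝ h ((cellChartHomeo n R∞).symm (g : Mat))) ((cellChartHomeo n R∞).symm (g : Mat)) :=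
    ((hs.differentiable (by simp)) _).hasFDerivAt
  have h2 := hh.comp_hasDerivAt_of_eq (0 : ℝ) h1 (by simp only [Function.comp_apply, zero_smul, expGL_zero, mul_one])
  exact h2.deriv

/-- **`L_X (cellPush h)` on the big cell.** [folklore] -/
theorem archLeftDeriv_cellPush_of_mem {h : E∞ → ℂ} (hs : ContDiff ℝ ∞ h) (X : Mat) {g : G∞} (hg : (g : Mat) ∈ bruhatBigCell n R∞) :
    archLeftDeriv X (cellPush h) g =
      fderiv ℝ h ((cellChartHomeo n R∞).symm (g : Mat))
        (fderiv ℝ (cellChartHomeo n R∞).symm (g : Mat) (-(X * (g : Mat)))) := by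
  unfold archLeftDeriv
  have hev_mem : ∀ᶠ s : ℝ in 𝓝 0, (((expGL (s • X))⁻¹ * g : G∞) : Mat) ∈ bruhatBigCell n R∞ := by
    have h0 : (((expGL ((0 : ℝ) • X))⁻¹ * g : G∞) : Mat) ∈ bruhatBigCell n R∞ := by
      simpa only [zero_smul, expGL_zero, inv_one, one_mul] using hg
    exact (continuous_coe_expGL_inv_mul g X).continuousAt.preimage_mem_nhds (isOpen_bruhatBigCell.mem_nhds h0)
  have hev : (fun s : ℝ => cellPush h ((expGL (s • X))⁻¹ * g)) =ᶠ[𝓝 0]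
      fun s : ℝ => h ((cellChartHomeo n R∞).symm (((expGL (s • X))⁻¹ * g : G∞) : Mat)) := by
    filter_upwards [hev_mem] with s hs'
    exact cellPush_apply_of_mem hs'
  rw [hev.deriv_eq]
  have hsymm : HasFDerivAt (cellChartHomeo n R∞).symm (fderiv ℝ (cellChartHomeo n R∞).symm (g : Mat)) (g : Mat) :=
    ((contDiffAt_cellChartHomeo_symm hg).differentiableAt (by simp)).hasFDerivAt
  have h1 := hsymm.comp_hasDerivAt_of_eq (0 : ℝ) (hasDerivAt_coe_expGL_inv_mul g X)
    (by simp only [zero_smul, expGL_zero, inv_one, one_mul])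
  have hh : HasFDerivAt h (fderiv ℝ h ((cellChartHomeo n R∞).symm (g : Mat))) ((cellChartHomeo n R∞).symm (g : Mat)) :=
    ((hs.differentiable (by simp)) _).hasFDerivAt
  have h2 := hh.comp_hasDerivAt_of_eq (0 : ℝ) h1
    (by simp only [Function.comp_apply, zero_smul, expGL_zero, inv_one, one_mul])
  exact h2.deriv

/-- **`R_X (cellPush h)` vanishes off the big cell** (the curve stays outside the compact `Ψ(tsupport h)`).
[folklore] -/
theorem archRightDeriv_cellPush_of_not_mem {h : E∞ → ℂ} (hh : HasCompactSupport h) (hW : tsupport h ⊆ cellSource n R∞) (X : Mat)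
    {g : G∞} (hg : (g : Mat) ∉ bruhatBigCell n R∞) : archRightDeriv X (cellPush h) g = 0 := by
  unfold archRightDeriv
  have hg' : ((g * expGL ((0 : ℝ) • X) : G∞) : Mat) ∉ cellChart '' tsupport h := by
    simpa only [zero_smul, expGL_zero, mul_one] using fun h' => hg (image_tsupport_subset hW h')
  have hev : (fun s : ℝ => cellPush h (g * expGL (s • X))) =ᶠ[𝓝 0] fun _ => 0 := by
    have hopen : IsOpen (cellChart '' tsupport h : Set Mat)ᶜ := (isCompact_image_tsupport hh).isClosed.isOpen_compl
    filter_upwards [(continuous_coe_mul_expGL g X).continuousAt.preimage_mem_nhds (hopen.mem_nhds hg')] with s hs'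
    exact cellPush_eq_zero_of_not_mem_image hs'
  rw [hev.deriv_eq, deriv_const]

/-- **`L_X (cellPush h)` vanishes off the big cell.** [folklore] -/
theorem archLeftDeriv_cellPush_of_not_mem {h : E∞ → ℂ} (hh : HasCompactSupport h) (hW : tsupport h ⊆ cellSource n R∞) (X : Mat)
    {g : G∞} (hg : (g : Mat) ∉ bruhatBigCell n R∞) : archLeftDeriv X (cellPush h) g = 0 := by
  unfold archLeftDeriv
  have hg' : (((expGL ((0 : ℝ) • X))⁻¹ * g : G∞) : Mat) ∉ cellChart '' tsupport h := by
    simpa only [zero_smul, expGL_zero, inv_one, one_mul] using fun h' => hg (image_tsupport_subset hW h')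
  have hev : (fun s : ℝ => cellPush h ((expGL (s • X))⁻¹ * g)) =ᶠ[𝓝 0] fun _ => 0 := by
    have hopen : IsOpen (cellChart '' tsupport h : Set Mat)ᶜ := (isCompact_image_tsupport hh).isClosed.isOpen_compl
    filter_upwards [(continuous_coe_expGL_inv_mul g X).continuousAt.preimage_mem_nhds (hopen.mem_nhds hg')] with s hs'
    exact cellPush_eq_zero_of_not_mem_image hs'
  rw [hev.deriv_eq, deriv_const]

/-- **`R_X (cellPush h) = cellPush (R̃_X h)`.** [folklore] -/
theorem archRightDeriv_cellPush {h : E∞ → ℂ} (hs : ContDiff ℝ ∞ h) (hh : HasCompactSupport h) (hW : tsupport h ⊆ cellSource n R∞)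
    (X : Mat) : archRightDeriv X (cellPush h) = cellPush (cellOpR X h) := by
  funext g
  by_cases hg : (g : Mat) ∈ bruhatBigCell n R∞
  · rw [archRightDeriv_cellPush_of_mem hs X hg, cellPush_apply_of_mem hg, cellOpR, vecField, cellVecR,
      ← cellChartHomeo_apply, (cellChartHomeo n R∞).right_inv hg]
  · rw [archRightDeriv_cellPush_of_not_mem hh hW X hg, cellPush_apply_of_not_mem hg]

/-- **`L_X (cellPush h) = cellPush (L̃_X h)`.** [folklore] -/
theorem archLeftDeriv_cellPush {h : E∞ → ℂ} (hs : ContDiff ℝ ∞ h) (hh : HasCompactSupport h) (hW : tsupport h ⊆ cellSource n R∞)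
    (X : Mat) : archLeftDeriv X (cellPush h) = cellPush (cellOpL X h) := by
  funext g
  by_cases hg : (g : Mat) ∈ bruhatBigCell n R∞
  · rw [archLeftDeriv_cellPush_of_mem hs X hg, cellPush_apply_of_mem hg, cellOpL, vecField, cellVecL,
      ← cellChartHomeo_apply, (cellChartHomeo n R∞).right_inv hg]
  · rw [archLeftDeriv_cellPush_of_not_mem hh hW X hg, cellPush_apply_of_not_mem hg]

/-- The iterated right operators in coordinates. [folklore] -/
def cellOpRWord : List Mat → (E∞ → ℂ) → (E∞ → ℂ)
  | [], h => h
  | X :: w, h => cellOpR X (cellOpRWord w h)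

/-- The iterated left operators in coordinates. [folklore] -/
def cellOpLWord : List Mat → (E∞ → ℂ) → (E∞ → ℂ)
  | [], h => h
  | X :: w, h => cellOpL X (cellOpLWord w h)

/-- Iterated operators preserve smoothness and support (right). [folklore] -/
theorem contDiff_cellOpRWord {h : E∞ → ℂ} (hs : ContDiff ℝ ∞ h) (hW : tsupport h ⊆ cellSource n R∞) :
    ∀ w : List Mat, ContDiff ℝ ∞ (cellOpRWord w h) ∧ tsupport (cellOpRWord w h) ⊆ tsupport h
  | [] => ⟨hs, subset_rfl⟩
  | X :: w => by
    obtain ⟨h1, h2⟩ := contDiff_cellOpRWord hs hW w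
    exact ⟨contDiff_cellOpR X h1 (h2.trans hW), (tsupport_cellOpR_subset X _).trans h2⟩

/-- Iterated operators preserve smoothness and support (left). [folklore] -/
theorem contDiff_cellOpLWord {h : E∞ → ℂ} (hs : ContDiff ℝ ∞ h) (hW : tsupport h ⊆ cellSource n R∞) :
    ∀ w : List Mat, ContDiff ℝ ∞ (cellOpLWord w h) ∧ tsupport (cellOpLWord w h) ⊆ tsupport h
  | [] => ⟨hs, subset_rfl⟩
  | X :: w => by
    obtain ⟨h1, h2⟩ := contDiff_cellOpLWord hs hW w
    exact ⟨contDiff_cellOpL X h1 (h2.trans hW), (tsupport_cellOpL_subset X _).trans h2⟩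

/-- **`R_w (cellPush h) = cellPush (R̃_w h)`.** [folklore] -/
theorem archRightWordDeriv_cellPush {h : E∞ → ℂ} (hs : ContDiff ℝ ∞ h) (hh : HasCompactSupport h) (hW : tsupport h ⊆ cellSource n R∞) :
    ∀ w : List Mat, archRightWordDeriv w (cellPush h) = cellPush (cellOpRWord w h)
  | [] => rfl
  | X :: w => by
    obtain ⟨h1, h2⟩ := contDiff_cellOpRWord hs hW w
    rw [archRightWordDeriv_cons, archRightWordDeriv_cellPush hs hh hW w, cellOpRWord,
      archRightDeriv_cellPush h1 (hh.mono' ((subset_tsupport _).trans h2)) (h2.trans hW) X]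

/-- **`L_u (cellPush h) = cellPush (L̃_u h)`.** [folklore] -/
theorem archLeftWordDeriv_cellPush {h : E∞ → ℂ} (hs : ContDiff ℝ ∞ h) (hh : HasCompactSupport h) (hW : tsupport h ⊆ cellSource n R∞) :
    ∀ w : List Mat, archLeftWordDeriv w (cellPush h) = cellPush (cellOpLWord w h)
  | [] => rfl
  | X :: w => by
    obtain ⟨h1, h2⟩ := contDiff_cellOpLWord hs hW w
    rw [archLeftWordDeriv_cons, archLeftWordDeriv_cellPush hs hh hW w, cellOpLWord,
      archLeftDeriv_cellPush h1 (hh.mono' ((subset_tsupport _).trans h2)) (h2.trans hW) X]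

/-- **`L_u R_v (cellPush h) = cellPush (L̃_u (R̃_v h))`.** [folklore] -/
theorem archLeftWordDeriv_archRightWordDeriv_cellPush {h : E∞ → ℂ} (hs : ContDiff ℝ ∞ h) (hh : HasCompactSupport h)
    (hW : tsupport h ⊆ cellSource n R∞) (u v : List Mat) :
    archLeftWordDeriv u (archRightWordDeriv v (cellPush h)) = cellPush (cellOpLWord u (cellOpRWord v h)) := by
  obtain ⟨h1, h2⟩ := contDiff_cellOpRWord hs hW v
  rw [archRightWordDeriv_cellPush hs hh hW v,
    archLeftWordDeriv_cellPush h1 (hh.mono' ((subset_tsupport _).trans h2)) (h2.trans hW) u]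

end FirstOrder

/-! ### 3. Normal form: smooth-coefficient combinations of basis word derivatives -/

section NormalForm

variable {d : ℕ} (b : Module.Basis (Fin d) ℝ (CellParam n (mixedSpace K)))

/-- **Operator data**: a list of (basis word, real coefficient function) pairs, standing for
`h ↦ Σ c · ∂_w h`. [folklore] -/
abbrev OpList (d : ℕ) : Type _ := List (List (Fin d) × (CellParam n (mixedSpace K) → ℝ))

/-- **Evaluation** of operator data on `h` at `e`: `Σ_{(w,c)} c(e) ∂_{w} h (e)` (`∂_w` along the basis `b`).
[folklore] -/
def evalOpList (L : OpList (n := n) (K := K) d) (h : E∞ → ℂ) (e : E∞) : ℂ :=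
  (L.map fun p => ((p.2 e : ℝ) : ℂ) * vecWordDeriv (p.1.map b) h e).sum

/-- `eval [] = 0`. [folklore] -/
@[simp] theorem evalOpList_nil (h : E∞ → ℂ) : evalOpList b ([] : OpList (n := n) (K := K) d) h = 0 := by
  funext e; simp [evalOpList]

/-- `eval ((w,c) :: L) h = c · ∂_w h + eval L h`. [folklore] -/
theorem evalOpList_cons (p : List (Fin d) × (E∞ → ℝ)) (L : OpList (n := n) (K := K) d) (h : E∞ → ℂ) :
    evalOpList b (p :: L) h = (fun e => ((p.2 e : ℝ) : ℂ) * vecWordDeriv (p.1.map b) h e) + evalOpList b L h := by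
  funext e; simp [evalOpList]

/-- `eval (L₁ ++ L₂) = eval L₁ + eval L₂`. [folklore] -/
theorem evalOpList_append (L₁ L₂ : OpList (n := n) (K := K) d) (h : E∞ → ℂ) :
    evalOpList b (L₁ ++ L₂) h = evalOpList b L₁ h + evalOpList b L₂ h := by
  funext e; simp [evalOpList, List.sum_append]

/-- **One step**: applying the vector field `ζ` to `Σ c ∂_w h` gives the data
`(w, ζ·c), (j :: w, ζ_j c)_j` for each `(w, c)`. [folklore] -/
def opListStep (ζ : E∞ → E∞) (L : OpList (n := n) (K := K) d) : OpList (n := n) (K := K) d :=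
  L.flatMap fun p =>
    (p.1, fun e => fderiv ℝ p.2 e (ζ e)) ::
      (List.finRange d).map fun j => (j :: p.1, fun e => b.coord j (ζ e) * p.2 e)

/-- Coefficients smooth on `cellSource`. [folklore] -/
def OpList.SmoothOn (L : OpList (n := n) (K := K) d) : Prop := ∀ p ∈ L, ContDiffOn ℝ ∞ p.2 (cellSource n R∞)

/-- Smoothness of coefficients of a cons. [folklore] -/
theorem OpList.smoothOn_cons {p : List (Fin d) × (E∞ → ℝ)} {L : OpList (n := n) (K := K) d} :
    OpList.SmoothOn (p :: L) ↔ ContDiffOn ℝ ∞ p.2 (cellSource n R∞) ∧ OpList.SmoothOn L := by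
  simp [OpList.SmoothOn]

/-- **The step preserves smoothness of coefficients** (for `ζ` smooth on `cellSource`). [folklore] -/
theorem smoothOn_opListStep {ζ : E∞ → E∞} (hζ : ContDiffOn ℝ ∞ ζ (cellSource n R∞)) {L : OpList (n := n) (K := K) d}
    (hL : OpList.SmoothOn L) : OpList.SmoothOn (opListStep b ζ L) := by
  intro q hq
  simp only [opListStep, List.mem_flatMap, List.mem_cons, List.mem_map, List.mem_finRange, true_and] at hq
  obtain ⟨p, hp, hq⟩ := hq
  have hc : ContDiffOn ℝ ∞ p.2 (cellSource n R∞) := hL p hp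
  rcases hq with rfl | ⟨j, rfl⟩
  · exact (hc.fderiv_of_isOpen isOpen_cellSource (by simp)).clm_apply hζ
  · have h1 : ContDiff ℝ ∞ fun v : E∞ => b.coord j v := (LinearMap.toContinuousLinearMap (b.coord j)).contDiff
    exact (h1.comp_contDiffOn hζ).mul hc

end NormalForm

section NormalForm2

variable {d : ℕ} (b : Module.Basis (Fin d) ℝ (CellParam n (mixedSpace K)))

/-- Word derivatives of a smooth function are smooth (no support hypothesis). [folklore] -/
theorem contDiff_vecWordDeriv {h : E∞ → ℂ} (hs : ContDiff ℝ ∞ h) : ∀ w : List E∞, ContDiff ℝ ∞ (vecWordDeriv w h)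
  | [] => hs
  | a :: w => by
    rw [vecWordDeriv_cons]
    have h1 : ContDiff ℝ ∞ (fderiv ℝ (vecWordDeriv w h)) := (contDiff_vecWordDeriv hs w).fderiv_right (m := ∞) (by simp)
    exact h1.clm_apply contDiff_const

/-- `eval L h` is differentiable at points of `cellSource`. [folklore] -/
theorem differentiableAt_evalOpList {L : OpList (n := n) (K := K) d} (hL : OpList.SmoothOn L) {h : E∞ → ℂ}
    (hs : ContDiff ℝ ∞ h) {e : E∞} (he : e ∈ cellSource n R∞) : DifferentiableAt ℝ (evalOpList b L h) e := by
  induction L with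
  | nil => rw [evalOpList_nil]; exact differentiableAt_const _
  | cons p L ih =>
    rw [evalOpList_cons]
    refine DifferentiableAt.add ?_ (ih (OpList.smoothOn_cons.1 hL).2)
    have hc : DifferentiableAt ℝ p.2 e :=
      ((OpList.smoothOn_cons.1 hL).1.contDiffAt (isOpen_cellSource.mem_nhds he)).differentiableAt (by simp)
    have hc' : DifferentiableAt ℝ (fun x => ((p.2 x : ℝ) : ℂ)) e := Complex.ofRealCLM.differentiableAt.comp e hc
    exact hc'.mul (((contDiff_vecWordDeriv hs _).differentiable (by simp)) e)

/-- **A derivative along `ζ e` expanded in the basis**: `Dd(e)[ζ e] = Σ_j ζ_j(e) ∂_{b_j} d (e)`. [folklore] -/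
theorem fderiv_apply_eq_sum_coord (d : E∞ → ℂ) (ζ : E∞ → E∞) (e : E∞) :
    fderiv ℝ d e (ζ e) = ∑ j, ((b.coord j (ζ e) : ℝ) : ℂ) * vecDeriv (b j) d e := by
  conv_lhs => rw [← b.sum_repr (ζ e)]
  rw [_root_.map_sum]
  refine Finset.sum_congr rfl fun j _ => ?_
  rw [map_smul, vecDeriv, Module.Basis.coord_apply, Complex.real_smul]

/-- Evaluation of the `ι`-indexed block of new terms. [folklore] -/
theorem evalOpList_map_finRange (w : List (Fin d)) (c : Fin d → E∞ → ℝ) (h : E∞ → ℂ) (e : E∞) :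
    evalOpList b ((List.finRange d).map fun j => (j :: w, c j)) h e =
      ∑ j, ((c j e : ℝ) : ℂ) * vecDeriv (b j) (vecWordDeriv (w.map b) h) e := by
  unfold evalOpList
  rw [List.map_map, ← Fin.sum_univ_def]
  refine Finset.sum_congr rfl fun j _ => ?_
  simp only [Function.comp_apply, List.map_cons, vecWordDeriv_cons]

/-- Evaluation of the step on a cons: the `1 + d` new terms of the head, then the step of the tail. [folklore] -/
theorem evalOpList_opListStep_cons (ζ : E∞ → E∞) (p : List (Fin d) × (E∞ → ℝ)) (L : OpList (n := n) (K := K) d)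
    (h : E∞ → ℂ) (e : E∞) :
    evalOpList b (opListStep b ζ (p :: L)) h e =
      ((fderiv ℝ p.2 e (ζ e) : ℝ) : ℂ) * vecWordDeriv (p.1.map b) h e +
        ∑ j, (((b.coord j (ζ e) * p.2 e : ℝ)) : ℂ) * vecDeriv (b j) (vecWordDeriv (p.1.map b) h) e +
        evalOpList b (opListStep b ζ L) h e := by
  show evalOpList b (((p.1, fun e => fderiv ℝ p.2 e (ζ e)) ::
      (List.finRange d).map fun j => (j :: p.1, fun e => b.coord j (ζ e) * p.2 e)) ++ opListStep b ζ L) h e = _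
  rw [evalOpList_append, evalOpList_cons, Pi.add_apply, Pi.add_apply]
  rw [evalOpList_map_finRange b p.1 (fun j e => b.coord j (ζ e) * p.2 e) h e]

/-- **The step identity**: `ζ · (Σ c ∂_w h) = Σ [(ζ·c) ∂_w h + Σ_j ζ_j c ∂_{j::w} h]` at points of `cellSource`.
[folklore] -/
theorem vecField_evalOpList {ζ : E∞ → E∞} {L : OpList (n := n) (K := K) d} (hL : OpList.SmoothOn L)
    {h : E∞ → ℂ} (hs : ContDiff ℝ ∞ h) {e : E∞} (he : e ∈ cellSource n R∞) :
    vecField ζ (evalOpList b L h) e = evalOpList b (opListStep b ζ L) h e := by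
  induction L with
  | nil =>
    simp only [evalOpList_nil, opListStep, List.flatMap_nil, vecField]
    rw [show (0 : E∞ → ℂ) = fun _ => (0 : ℂ) from rfl, fderiv_fun_const]
    rfl
  | cons p L ih =>
    have hLs := (OpList.smoothOn_cons.1 hL).2
    have hc : DifferentiableAt ℝ p.2 e :=
      ((OpList.smoothOn_cons.1 hL).1.contDiffAt (isOpen_cellSource.mem_nhds he)).differentiableAt (by simp)
    have hc' : DifferentiableAt ℝ (fun x => ((p.2 x : ℝ) : ℂ)) e := Complex.ofRealCLM.differentiableAt.comp e hc
    have hd : DifferentiableAt ℝ (vecWordDeriv (p.1.map b) h) e := ((contDiff_vecWordDeriv hs _).differentiable (by simp)) e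
    have hrest : DifferentiableAt ℝ (evalOpList b L h) e := differentiableAt_evalOpList b hLs hs he
    -- left side: product rule on the first term plus the induction hypothesis
    rw [evalOpList_cons]
    have hF : DifferentiableAt ℝ (fun e => ((p.2 e : ℝ) : ℂ) * vecWordDeriv (p.1.map b) h e) e := hc'.mul hd
    unfold vecField
    rw [fderiv_add hF hrest, _root_.add_apply, ← vecField, ← vecField, ih hLs]
    rw [show vecField ζ (fun e => ((p.2 e : ℝ) : ℂ) * vecWordDeriv (p.1.map b) h e) e =
        fderiv ℝ (fun e => ((p.2 e : ℝ) : ℂ) * vecWordDeriv (p.1.map b) h e) e (ζ e) from rfl,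
      fderiv_fun_mul hc' hd, _root_.add_apply, _root_.smul_apply, _root_.smul_apply,
      fderiv_apply_eq_sum_coord b (vecWordDeriv (p.1.map b) h) ζ e]
    have hofReal : fderiv ℝ (fun x => ((p.2 x : ℝ) : ℂ)) e (ζ e) = ((fderiv ℝ p.2 e (ζ e) : ℝ) : ℂ) := by
      rw [show (fun x => ((p.2 x : ℝ) : ℂ)) = Complex.ofRealCLM ∘ p.2 from rfl, fderiv_comp e Complex.ofRealCLM.differentiableAt hc,
        ContinuousLinearMap.fderiv]
      rfl
    rw [hofReal]
    -- right side: the step on `p :: L`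
    rw [evalOpList_opListStep_cons]
    have hterm : ∀ j : Fin d, ((p.2 e : ℝ) : ℂ) * (((b.coord j (ζ e) : ℝ) : ℂ) * vecDeriv (b j) (vecWordDeriv (p.1.map b) h) e) =
        (((b.coord j (ζ e) * p.2 e : ℝ)) : ℂ) * vecDeriv (b j) (vecWordDeriv (List.map b p.1) h) e := by
      intro j; push_cast; ring
    simp only [smul_eq_mul]
    rw [Finset.mul_sum]
    simp only [hterm]
    ring

/-- **Applying a list of vector fields**: `applyFields [ζ₁, …, ζ_k] h = ζ₁ · (⋯ (ζ_k · h))`. [folklore] -/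
def applyFields : List (E∞ → E∞) → (E∞ → ℂ) → (E∞ → ℂ)
  | [], h => h
  | ζ :: Z, h => vecField ζ (applyFields Z h)

/-- **Operator data of a list of vector fields.** [folklore] -/
def opListOfFields : List (E∞ → E∞) → OpList (n := n) (K := K) d
  | [] => [([], fun _ => 1)]
  | ζ :: Z => opListStep b ζ (opListOfFields Z)

/-- The data of the empty list evaluates to `h`. [folklore] -/
theorem evalOpList_opListOfFields_nil (h : E∞ → ℂ) : evalOpList b (opListOfFields b ([] : List (E∞ → E∞))) h = h := by
  funext e; simp [opListOfFields, evalOpList]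

/-- Coefficients of `opListOfFields` are smooth on `cellSource` when the fields are. [folklore] -/
theorem smoothOn_opListOfFields : ∀ (Z : List (E∞ → E∞)) (_hZ : ∀ ζ ∈ Z, ContDiffOn ℝ ∞ ζ (cellSource n R∞)),
    OpList.SmoothOn (opListOfFields b Z)
  | [], _ => fun p hp => by
    simp only [opListOfFields, List.mem_singleton] at hp
    subst hp
    exact contDiffOn_const
  | ζ :: Z, hZ => smoothOn_opListStep b (hZ ζ List.mem_cons_self)
      (smoothOn_opListOfFields Z fun ξ hξ => hZ ξ (List.mem_cons_of_mem _ hξ))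

/-- The data of a list of fields is never empty. [folklore] -/
theorem opListOfFields_ne_nil : ∀ Z : List (E∞ → E∞), opListOfFields b Z ≠ ([] : OpList (n := n) (K := K) d)
  | [] => by simp [opListOfFields]
  | ζ :: Z => by
    have ih := opListOfFields_ne_nil Z
    obtain ⟨p, L, hpL⟩ := List.exists_cons_of_ne_nil ih
    rw [opListOfFields, hpL, opListStep, List.flatMap_cons]
    exact fun h => List.cons_ne_nil _ _ (List.append_eq_nil_iff.1 h).1

/-- **Normal form on `cellSource`**: `applyFields Z h = Σ c_w ∂_w h` there. [folklore] -/
theorem applyFields_eqOn : ∀ (Z : List (E∞ → E∞)) (_hZ : ∀ ζ ∈ Z, ContDiffOn ℝ ∞ ζ (cellSource n R∞))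
    {h : E∞ → ℂ} (_hs : ContDiff ℝ ∞ h), EqOn (applyFields Z h) (evalOpList b (opListOfFields b Z) h) (cellSource n R∞)
  | [], _, h, _ => fun e _ => by rw [evalOpList_opListOfFields_nil]; rfl
  | ζ :: Z, hZ, h, hs => fun e he => by
    have ih := applyFields_eqOn Z (fun ξ hξ => hZ ξ (List.mem_cons_of_mem _ hξ)) hs
    have hev : applyFields Z h =ᶠ[𝓝 e] evalOpList b (opListOfFields b Z) h :=
      (isOpen_cellSource.eventually_mem he).mono ih
    show vecField ζ (applyFields Z h) e = evalOpList b (opListStep b ζ (opListOfFields b Z)) h e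
    rw [vecField, hev.fderiv_eq, ← vecField]
    exact vecField_evalOpList b (smoothOn_opListOfFields b Z fun ξ hξ => hZ ξ (List.mem_cons_of_mem _ hξ)) hs he

/-- **The bound on a compact set**: `|Σ c_w(e) ∂_w h(e)| ≤ C · M` on `κ` if `|∂_w h| ≤ M` for the words of `L`.
[folklore] -/
theorem exists_bound_evalOpList {κ : Set E∞} (hκ : IsCompact κ) (hκW : κ ⊆ cellSource n R∞) :
    ∀ (L : OpList (n := n) (K := K) d) (_hL : OpList.SmoothOn L), ∃ C : ℝ, 0 ≤ C ∧
      ∀ (h : E∞ → ℂ) (M : ℝ), (∀ p ∈ L, ∀ x, ‖vecWordDeriv (p.1.map b) h x‖ ≤ M) →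
        ∀ e ∈ κ, ‖evalOpList b L h e‖ ≤ C * M
  | [], _ => ⟨0, le_rfl, fun h M _ e _ => by simp [evalOpList_nil]⟩
  | p :: L, hL => by
    obtain ⟨C, hC, hbd⟩ := exists_bound_evalOpList hκ hκW L (OpList.smoothOn_cons.1 hL).2
    obtain ⟨B, hB⟩ := hκ.exists_bound_of_continuousOn (((OpList.smoothOn_cons.1 hL).1.continuousOn).mono hκW)
    refine ⟨max B 0 + C, by positivity, fun h M hM e he => ?_⟩
    rw [evalOpList_cons, Pi.add_apply]
    have h1 : ‖((p.2 e : ℝ) : ℂ) * vecWordDeriv (p.1.map b) h e‖ ≤ max B 0 * M := by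
      rw [norm_mul, Complex.norm_real]
      calc ‖p.2 e‖ * ‖vecWordDeriv (p.1.map b) h e‖ ≤ max B 0 * ‖vecWordDeriv (p.1.map b) h e‖ :=
            mul_le_mul_of_nonneg_right ((hB e he).trans (le_max_left _ _)) (norm_nonneg _)
        _ ≤ max B 0 * M := mul_le_mul_of_nonneg_left (hM p List.mem_cons_self e) (le_max_right _ _)
    have h2 := hbd h M (fun q hq x => hM q (List.mem_cons_of_mem _ hq) x) e he
    calc _ ≤ ‖((p.2 e : ℝ) : ℂ) * vecWordDeriv (p.1.map b) h e‖ + ‖evalOpList b L h e‖ := norm_add_le _ _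
      _ ≤ max B 0 * M + C * M := add_le_add h1 h2
      _ = (max B 0 + C) * M := by ring

end NormalForm2

/-! ### 4. The words of `GL_n(K_∞)` in normal form; the pulled-back functional is of finite order -/

section Pull

variable {d : ℕ} (b : Module.Basis (Fin d) ℝ (CellParam n (mixedSpace K)))

/-- `R̃_v h = applyFields (v.map cellVecR) h`. [folklore] -/
theorem cellOpRWord_eq_applyFields (h : E∞ → ℂ) : ∀ v : List Mat, cellOpRWord v h = applyFields (v.map cellVecR) h
  | [] => rfl
  | X :: v => by rw [cellOpRWord, cellOpRWord_eq_applyFields h v]; rfl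

/-- `L̃_u g = applyFields (u.map cellVecL) g`. [folklore] -/
theorem cellOpLWord_eq_applyFields (g : E∞ → ℂ) : ∀ u : List Mat, cellOpLWord u g = applyFields (u.map cellVecL) g
  | [] => rfl
  | X :: u => by rw [cellOpLWord, cellOpLWord_eq_applyFields g u]; rfl

/-- `applyFields (Z₁ ++ Z₂) = applyFields Z₁ ∘ applyFields Z₂`. [folklore] -/
theorem applyFields_append (Z₂ : List (E∞ → E∞)) (h : E∞ → ℂ) :
    ∀ Z₁ : List (E∞ → E∞), applyFields (Z₁ ++ Z₂) h = applyFields Z₁ (applyFields Z₂ h)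
  | [] => rfl
  | ζ :: Z₁ => by rw [List.cons_append, applyFields, applyFields_append Z₂ h Z₁]; rfl

/-- The fields of a pair of words. [folklore] -/
def fieldsOfWords (u v : List Mat) : List (E∞ → E∞) := u.map (cellVecL (n := n) (K := K)) ++ v.map cellVecR

/-- All the fields of `fieldsOfWords u v` are smooth on `cellSource`. [folklore] -/
theorem contDiffOn_fieldsOfWords (u v : List Mat) : ∀ ζ ∈ fieldsOfWords (n := n) (K := K) u v, ContDiffOn ℝ ∞ ζ (cellSource n R∞) := by
  intro ζ hζ
  simp only [fieldsOfWords, List.mem_append, List.mem_map] at hζ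
  rcases hζ with ⟨X, _, rfl⟩ | ⟨X, _, rfl⟩
  · exact contDiffOn_cellVecL X
  · exact contDiffOn_cellVecR X

/-- **`L̃_u R̃_v h` in normal form on `cellSource`.** [folklore] -/
theorem cellOpLWord_cellOpRWord_eqOn (u v : List Mat) {h : E∞ → ℂ} (hs : ContDiff ℝ ∞ h) :
    EqOn (cellOpLWord u (cellOpRWord v h)) (evalOpList b (opListOfFields b (fieldsOfWords u v)) h) (cellSource n R∞) := by
  rw [cellOpRWord_eq_applyFields, cellOpLWord_eq_applyFields, ← applyFields_append]
  exact applyFields_eqOn b (fieldsOfWords u v) (contDiffOn_fieldsOfWords u v) hs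

/-- The basis words appearing in the normal form of `(u, v)`. [folklore] -/
def wordsOfPair (u v : List Mat) : Finset (List E∞) :=
  ((opListOfFields b (fieldsOfWords u v)).map fun p => p.1.map b).toFinset

/-- **The key estimate**: `sup |L_u R_v (cellPush h)| ≤ C · M` whenever `|∂_w h| ≤ M` for the finitely many
basis words `w ∈ wordsOfPair u v`, for `h` smooth with `tsupport h ⊆ κ ⊆ cellSource`, `κ` compact. [folklore] -/
theorem exists_bound_wordDeriv_cellPush {κ : Set E∞} (hκ : IsCompact κ) (hκW : κ ⊆ cellSource n R∞) (u v : List Mat) :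
    ∃ C : ℝ, 0 ≤ C ∧ ∀ (h : E∞ → ℂ), ContDiff ℝ ∞ h → HasCompactSupport h → tsupport h ⊆ κ →
      ∀ M : ℝ, (∀ w ∈ wordsOfPair b u v, ∀ x, ‖vecWordDeriv w h x‖ ≤ M) →
        ∀ g : G∞, ‖archLeftWordDeriv u (archRightWordDeriv v (cellPush h)) g‖ ≤ C * M := by
  obtain ⟨C, hC, hbd⟩ := exists_bound_evalOpList b hκ hκW (opListOfFields b (fieldsOfWords u v))
    (smoothOn_opListOfFields b _ (contDiffOn_fieldsOfWords u v))
  refine ⟨C, hC, fun h hs hh hκh M hM g => ?_⟩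
  have hW : tsupport h ⊆ cellSource n R∞ := hκh.trans hκW
  rw [archLeftWordDeriv_archRightWordDeriv_cellPush hs hh hW u v]
  -- `M ≥ 0`: the empty word lies in `wordsOfPair` only sometimes, so argue through a point estimate instead
  have hM' : ∀ p ∈ opListOfFields b (fieldsOfWords u v), ∀ x, ‖vecWordDeriv (p.1.map b) h x‖ ≤ M :=
    fun p hp x => hM _ (List.mem_toFinset.2 (List.mem_map.2 ⟨p, hp, rfl⟩)) x
  have hMnn : 0 ≤ M := by
    have hne : opListOfFields b (fieldsOfWords (n := n) (K := K) u v) ≠ [] := opListOfFields_ne_nil b _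
    obtain ⟨p, hp⟩ := List.exists_mem_of_ne_nil _ hne
    exact (norm_nonneg _).trans (hM' p hp 0)
  by_cases hg : (g : Mat) ∈ bruhatBigCell n R∞
  · rw [cellPush_apply_of_mem hg]
    set e := (cellChartHomeo n R∞).symm (g : Mat) with he
    by_cases heκ : e ∈ κ
    · rw [cellOpLWord_cellOpRWord_eqOn b u v hs (hκW heκ)]
      exact hbd h M hM' e heκ
    · -- outside `κ ⊇ tsupport h` the iterated operator vanishes
      have hsupp : tsupport (cellOpLWord u (cellOpRWord v h)) ⊆ tsupport h := by
        obtain ⟨_, h2⟩ := contDiff_cellOpRWord hs hW v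
        obtain ⟨_, h4⟩ := contDiff_cellOpLWord (contDiff_cellOpRWord hs hW v).1 (h2.trans hW) u
        exact h4.trans h2
      rw [image_eq_zero_of_notMem_tsupport fun h' => heκ (hκh (hsupp h')), norm_zero]
      exact mul_nonneg hC hMnn
  · rw [cellPush_apply_of_not_mem hg, norm_zero]
    exact mul_nonneg hC hMnn

end Pull

/-! ### 5. The pulled-back functional `h ↦ T (cellPush h)` is additive, homogeneous and of finite order -/

section Functional

variable {d : ℕ} (b : Module.Basis (Fin d) ℝ (CellParam n (mixedSpace K)))

/-- `cellPush h` as a member of `archTestFunctions`, for admissible `h`. [folklore] -/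
def cellPushFn (h : E∞ → ℂ) (hh : IsTestFn h ∧ tsupport h ⊆ cellSource n R∞) : ↥(archTestFunctions n K) :=
  ⟨cellPush h, isArchTestFunction_cellPush hh.1.contDiff hh.1.hasCompactSupport hh.2⟩

/-- The underlying function of `cellPushFn h`. [folklore] -/
@[simp] theorem coe_cellPushFn (h : E∞ → ℂ) (hh : IsTestFn h ∧ tsupport h ⊆ cellSource n R∞) :
    ((cellPushFn h hh : ↥(archTestFunctions n K)) : G∞ → ℂ) = cellPush h := rfl

/-- **The pulled-back functional** `cellPull T h = T (cellPush h)` for admissible `h` (smooth, compactly supported,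
`tsupport h ⊆ cellSource`), `0` otherwise. [folklore] -/
def cellPull (T : ↥(archTestFunctions n K) →ₗ[ℂ] ℂ) (h : E∞ → ℂ) : ℂ :=
  if hh : IsTestFn h ∧ tsupport h ⊆ cellSource n R∞ then T (cellPushFn h hh) else 0

variable (T : ↥(archTestFunctions n K) →ₗ[ℂ] ℂ)

/-- `cellPull T h = T (cellPush h)` for admissible `h`. [folklore] -/
theorem cellPull_eq {h : E∞ → ℂ} (hh : IsTestFn h) (hW : tsupport h ⊆ cellSource n R∞) :
    cellPull T h = T (cellPushFn h ⟨hh, hW⟩) := dif_pos ⟨hh, hW⟩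

/-- **Additivity** of `cellPull T` on admissible functions. [folklore] -/
theorem cellPull_add (f g : E∞ → ℂ) (hf : IsTestFn f) (hg : IsTestFn g) (hfW : tsupport f ⊆ cellSource n R∞)
    (hgW : tsupport g ⊆ cellSource n R∞) : cellPull T (f + g) = cellPull T f + cellPull T g := by
  have hfgW : tsupport (f + g) ⊆ cellSource n R∞ := (tsupport_add _ _).trans (union_subset hfW hgW)
  rw [cellPull_eq T (hf.add hg) hfgW, cellPull_eq T hf hfW, cellPull_eq T hg hgW, ← map_add]
  congr 1
  apply Subtype.ext
  simp only [coe_cellPushFn, Submodule.coe_add, cellPush_add]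

/-- **Homogeneity** of `cellPull T` on admissible functions. [folklore] -/
theorem cellPull_smul (c : ℂ) (f : E∞ → ℂ) (hf : IsTestFn f) (hfW : tsupport f ⊆ cellSource n R∞) :
    cellPull T (c • f) = c * cellPull T f := by
  have hcW : tsupport (c • f) ⊆ cellSource n R∞ := (tsupport_smul_subset_right (fun _ : E∞ => c) f).trans hfW
  rw [cellPull_eq T (hf.smul c) hcW, cellPull_eq T hf hfW, ← smul_eq_mul, ← map_smul]
  congr 1
  apply Subtype.ext
  simp only [coe_cellPushFn, Submodule.coe_smul, cellPush_smul]

/-- `val⁻¹(Ψ(S))` is compact for a compact `S ⊆ cellSource`. [folklore] -/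
theorem isCompact_preimage_val_image {S : Set E∞} (hS : IsCompact S) (hSW : S ⊆ cellSource n R∞) :
    IsCompact (((↑) : G∞ → Mat) ⁻¹' (cellChart '' S)) := by
  have hc : IsCompact (cellChart '' S : Set Mat) := hS.image contDiff_cellChart.continuous
  have hsub : (cellChart '' S : Set Mat) ⊆ bruhatBigCell n R∞ := fun _ ⟨e, he, hge⟩ =>
    hge ▸ (cellChartHomeo n R∞).map_source (hSW he)
  rw [Units.isOpenEmbedding_val.isInducing.isCompact_iff, image_preimage_eq_inter_range,
    inter_eq_left.2 (hsub.trans bruhatBigCell_subset_range)]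
  exact hc

include b in
/-- **The pulled-back functional is of finite order on `cellSource`.** For a compact `κ ⊆ cellSource` the
continuity estimate of `T` on `val⁻¹(Ψ κ)` (`IsArchDistribution`) and the key estimate
`exists_bound_wordDeriv_cellPush` give `|T (cellPush h)| ≤ C' max_{w ∈ 𝒲} sup |∂_w h|`.
[cite: HormanderALPDO1, Def. 2.1.1] -/
theorem isFiniteOrderOn_cellPull (hT : IsArchDistribution n K T) : IsFiniteOrderOn (cellSource n R∞) (cellPull T) := by
  intro κ hκ hκW
  obtain ⟨C, 𝒮, hC, hbd⟩ := hT _ (isCompact_preimage_val_image hκ hκW)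
  choose Cp hCp hCbd using fun p : List Mat × List Mat => exists_bound_wordDeriv_cellPush b hκ hκW p.1 p.2
  set Csum : ℝ := ∑ p ∈ 𝒮, Cp p with hCsum
  have hCsum_nn : 0 ≤ Csum := Finset.sum_nonneg fun p _ => hCp p
  have hCp_le : ∀ p ∈ 𝒮, Cp p ≤ Csum := fun p hp =>
    Finset.single_le_sum (fun q _ => hCp q) hp
  refine ⟨C * Csum, insert [] (𝒮.biUnion fun p => wordsOfPair b p.1 p.2), mul_nonneg hC hCsum_nn, ?_⟩
  intro h hh hκh M hM
  have hW : tsupport h ⊆ cellSource n R∞ := hκh.trans hκW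
  have hMnn : 0 ≤ M := (norm_nonneg (h 0)).trans (hM [] (Finset.mem_insert_self _ _) 0)
  rw [cellPull_eq T hh hW]
  have hsupp : tsupport ((cellPushFn h ⟨hh, hW⟩ : ↥(archTestFunctions n K)) : G∞ → ℂ) ⊆
      ((↑) : G∞ → Mat) ⁻¹' (cellChart '' κ) := by
    rw [coe_cellPushFn]
    exact (tsupport_cellPush_subset hh.hasCompactSupport).trans (preimage_mono (image_mono hκh))
  have hwords : ∀ p ∈ 𝒮, ∀ g : G∞,
      ‖archLeftWordDeriv p.1 (archRightWordDeriv p.2 ((cellPushFn h ⟨hh, hW⟩ : ↥(archTestFunctions n K)) : G∞ → ℂ)) g‖ ≤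
        Csum * M := by
    intro p hp g
    rw [coe_cellPushFn]
    have h1 := hCbd p h hh.contDiff hh.hasCompactSupport hκh M
      (fun w hw x => hM w (Finset.mem_insert_of_mem (Finset.mem_biUnion.2 ⟨p, hp, hw⟩)) x) g
    exact h1.trans (mul_le_mul_of_nonneg_right (hCp_le p hp) hMnn)
  calc ‖T (cellPushFn h ⟨hh, hW⟩)‖ ≤ C * (Csum * M) := hbd _ hsupp _ hwords
    _ = C * Csum * M := by ring

end Functional

end Literature.NumberTheory.Automorphic
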